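import Summits.ResolutionOfSingularities.ResolutionOfSingularities.Theses.WeightedInvariant
import Literature.AlgebraicGeometry.Resolution.NonReducedNoResolution
import Literature.AlgebraicGeometry.Resolution.AbsoluteIntegralClosureNoResolution
import Literature.AlgebraicGeometry.Motives.VarietiesProjectiveSpaceProofs

/-!
# `DatumToEmbedded` — negative lemmas II: load-bearing hypotheses of the conclusion block

Support (negative) lemmas for crux `stmt-ResolutionOfSingularities-0572` (`DatumToEmbedded`), filed
by the standing disprover (cdisprove gen 1, cycle 1; work file `Cruxes/DatumToEmbedded/Disproof.lean`;
companion `Negative/LoadBearing.lean`). No definition; every dropped-hypothesis variant is inline.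

* `smoothOfRelativeDimension_affineSpace`, `smooth_affineSpace`: `𝔸ⁿ_k → Spec k` is smooth (of
  relative dimension `n`), from the tree's `isStandardSmoothOfRelativeDimension_mvPolynomial_fin`.
* `datumToEmbedded_false_without_isIntegral_at` — with `IsIntegral X` dropped the conclusion block is
  FALSE at every prime: the fat point `Spec 𝔽_p[ε] ↪ 𝔸¹_{𝔽_p}` (`exists_isClosedImmersion_dualNumber`)
  has no resolution (`not_hasResolution_spec_dualNumber`). Consequently
  `datumToEmbedded_without_isIntegral_iff_forall_isEmpty`: the crux without `IsIntegral` is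
  EQUIVALENT to "no weighted resolution datum exists at any prime", and
  `not_construction_and_datumToEmbedded_without_isIntegral`.
* `datumToEmbedded_false_without_isClosedImmersion_at` (any `i : X → Y`; witness
  `Spec 𝔽_p[X]⁺ → Spec 𝔽_p`, `f = 𝟙`) and `datumToEmbedded_false_without_smooth_at` (witness
  `Y = X = Spec 𝔽_p[X]⁺`, `i = 𝟙`): both FALSE at every prime by
  `not_hasResolution_spec_absoluteIntegralClosure`; what the two hypotheses jointly carry is finite
  type of `X` (see `datumToEmbedded_conclusion_finiteType_iff` in the companion file).

## Sources
* Folklore on in-tree witnesses (`NonReducedNoResolution.lean`,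
  `AbsoluteIntegralClosureNoResolution.lean`); Hartshorne III §10 Example 10.0.1 (`𝔸ⁿ` smooth).
-/

noncomputable section

open CategoryTheory AlgebraicGeometry TopologicalSpace
open Literature.AlgebraicGeometry.Resolution
open Summit.ResolutionOfSingularities.ResolutionOfSingularities.Theses.WeightedInvariant

set_option linter.dupNamespace false

namespace Summit.ResolutionOfSingularities.ResolutionOfSingularities.Theorems.DatumToEmbedded.Negative

section AffineSpace

/-- **`𝔸ⁿ_k → Spec k` is smooth of relative dimension `n`** (`k` any commutative ring would do; a
field here): `k → k[y₁,…,yₙ]` is standard smooth of relative dimension `n` (tree: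
`isStandardSmoothOfRelativeDimension_mvPolynomial_fin`), and Mathlib's `SmoothOfRelativeDimension`
has ring-hom property `Locally (IsStandardSmoothOfRelativeDimension n)`. [cite: Hartshorne1977, III §10 Example 10.0.1] -/
theorem smoothOfRelativeDimension_affineSpace (k : Type) [Field k] (n : ℕ) :
    SmoothOfRelativeDimension n
      (Spec.map (CommRingCat.ofHom (algebraMap k (MvPolynomial (Fin n) k)))) := by
  rw [HasRingHomProperty.Spec_iff (P := @SmoothOfRelativeDimension n)]
  exact RingHom.locally_of RingHom.isStandardSmoothOfRelativeDimension_respectsIso _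
    ((RingHom.isStandardSmoothOfRelativeDimension_algebraMap n).mpr
      (Literature.AlgebraicGeometry.Motives.ProjectiveSpace.isStandardSmoothOfRelativeDimension_mvPolynomial_fin
        k n))

/-- `𝔸ⁿ_k → Spec k` is smooth. [cite: Hartshorne1977, III §10 Example 10.0.1] -/
theorem smooth_affineSpace (k : Type) [Field k] (n : ℕ) :
    Smooth (Spec.map (CommRingCat.ofHom (algebraMap k (MvPolynomial (Fin n) k)))) :=
  haveI := smoothOfRelativeDimension_affineSpace k n
  SmoothOfRelativeDimension.smooth n _

end AffineSpace

section Integral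

/-- **The fat point is a closed subscheme of the affine line**: `k[y] → k[ε]`, `y ↦ ε`, is
surjective (`a + bε` is the image of `a + b y`), so its `Spec` is a closed immersion
`Spec k[ε] ↪ 𝔸¹_k`. [folklore] -/
theorem exists_isClosedImmersion_dualNumber (k : Type) [Field k] :
    ∃ i : Spec (.of (DualNumber k)) ⟶ Spec (.of (MvPolynomial (Fin 1) k)), IsClosedImmersion i := by
  let φ : MvPolynomial (Fin 1) k →ₐ[k] DualNumber k := MvPolynomial.aeval fun _ => DualNumber.eps
  have hφ : Function.Surjective φ := by
    intro x
    refine ⟨MvPolynomial.C x.fst + MvPolynomial.C x.snd * MvPolynomial.X 0, ?_⟩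
    rw [map_add, map_mul, MvPolynomial.aeval_C, MvPolynomial.aeval_C, MvPolynomial.aeval_X]
    obtain ⟨a, b⟩ := x
    change TrivSqZeroExt.inl a + TrivSqZeroExt.inl b * TrivSqZeroExt.inr 1 = (a, b)
    rw [TrivSqZeroExt.inl_mul_inr, smul_eq_mul, mul_one]
    exact TrivSqZeroExt.inl_fst_add_inr_snd_eq (a, b)
  exact ⟨Spec.map (CommRingCat.ofHom φ.toRingHom), IsClosedImmersion.spec_of_surjective _ hφ⟩

/-- **`IsIntegral X` is load-bearing: at every prime the conclusion block with `IsIntegral X`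
dropped is FALSE.** Witness: the fat point `Spec 𝔽_p[ε] ↪ 𝔸¹_{𝔽_p}` (closed immersion: `y ↦ ε`
is surjective; `𝔸¹ → Spec 𝔽_p` smooth, affine hence separated and quasi-compact; `𝔽_p` perfect),
and `Spec 𝔽_p[ε]` has no resolution (`not_hasResolution_spec_dualNumber`: a regular stalk would be
a domain containing the non-zero nilpotent `ε`). [folklore] -/
theorem datumToEmbedded_false_without_isIntegral_at (p : ℕ) [Fact p.Prime] :
    ¬ ∀ (k : Type) [Field k] [CharP k p] [PerfectField k] (Y X : Scheme.{0})
        (f : Y ⟶ Spec (.of k)) (i : X ⟶ Y), Smooth f → IsSeparated f → QuasiCompact f →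
          IsClosedImmersion i → Scheme.HasResolution X := by
  intro h
  let f : Spec (.of (MvPolynomial (Fin 1) (ZMod p))) ⟶ Spec (.of (ZMod p)) :=
    Spec.map (CommRingCat.ofHom (algebraMap (ZMod p) (MvPolynomial (Fin 1) (ZMod p))))
  obtain ⟨i, hi⟩ := exists_isClosedImmersion_dualNumber (ZMod p)
  haveI : Smooth f := smooth_affineSpace (ZMod p) 1
  exact not_hasResolution_spec_dualNumber (ZMod p)
    (h (ZMod p) _ _ f i inferInstance inferInstance inferInstance hi)

/-- **Without `IsIntegral X` the crux is EQUIVALENT to "no weighted resolution datum exists at any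
prime"** (`¬` of `WeightedConstruction` at EVERY prime): its conclusion block is false at every prime,
so it holds iff its hypothesis is never met. In particular it is refutable exactly when stmt-0571
is provable at some prime — the same door as for the crux itself, with the open problem removed.
[folklore] -/
theorem datumToEmbedded_without_isIntegral_iff_forall_isEmpty :
    (∀ p : ℕ, p.Prime → Nonempty (WeightedResolutionDatum p) →
      ∀ (k : Type) [Field k] [CharP k p] [PerfectField k] (Y X : Scheme.{0})
        (f : Y ⟶ Spec (.of k)) (i : X ⟶ Y), Smooth f → IsSeparated f → QuasiCompact f →
          IsClosedImmersion i → Scheme.HasResolution X) ↔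
      ∀ p : ℕ, p.Prime → IsEmpty (WeightedResolutionDatum p) := by
  constructor
  · intro h p hp
    refine ⟨fun D => ?_⟩
    haveI : Fact p.Prime := ⟨hp⟩
    exact datumToEmbedded_false_without_isIntegral_at p (h p hp ⟨D⟩)
  · intro h p hp hD
    exact ((h p hp).false hD.some).elim

/-- Hence `WeightedConstruction` and the integral-free crux are jointly inconsistent (any proof of
the crux must use `IsIntegral X`, or at least reducedness, as soon as one datum exists).
[folklore] -/
theorem not_construction_and_datumToEmbedded_without_isIntegral :
    ¬ (WeightedConstruction ∧
      (∀ p : ℕ, p.Prime → Nonempty (WeightedResolutionDatum p) →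
        ∀ (k : Type) [Field k] [CharP k p] [PerfectField k] (Y X : Scheme.{0})
          (f : Y ⟶ Spec (.of k)) (i : X ⟶ Y), Smooth f → IsSeparated f → QuasiCompact f →
            IsClosedImmersion i → Scheme.HasResolution X)) :=
  fun ⟨hC, h⟩ =>
    (datumToEmbedded_without_isIntegral_iff_forall_isEmpty.mp h 2 Nat.prime_two).false
      (hC 2 Nat.prime_two).some

end Integral

section FiniteType

open Polynomial in
/-- **`IsClosedImmersion i` is load-bearing: with `i : X → Y` arbitrary the block is FALSE at every
prime.** Witness: `Y = Spec 𝔽_p` (smooth over itself), `X = Spec 𝔽_p[X]⁺` the absolute integral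
closure of the affine line (integral: a subring of a field), `i` its structure map;
`Spec 𝔽_p[X]⁺` has no resolution (`not_hasResolution_spec_absoluteIntegralClosure`: every
non-generic stalk is non-Noetherian). [folklore] -/
theorem datumToEmbedded_false_without_isClosedImmersion_at (p : ℕ) [Fact p.Prime] :
    ¬ ∀ (k : Type) [Field k] [CharP k p] [PerfectField k] (Y X : Scheme.{0})
        (f : Y ⟶ Spec (.of k)) (i : X ⟶ Y), Smooth f → IsSeparated f → QuasiCompact f →
          IsIntegral X → Scheme.HasResolution X := by
  intro h
  let i : Spec (.of ↥(integralClosure (ZMod p)[X] (AlgebraicClosure (RatFunc (ZMod p))))) ⟶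
      Spec (.of (ZMod p)) :=
    Spec.map (CommRingCat.ofHom ((algebraMap (ZMod p)[X]
      ↥(integralClosure (ZMod p)[X] (AlgebraicClosure (RatFunc (ZMod p))))).comp Polynomial.C))
  exact not_hasResolution_spec_absoluteIntegralClosure p
    (h (ZMod p) (Spec (.of (ZMod p))) _ (𝟙 _) i inferInstance inferInstance inferInstance
      inferInstance)

open Polynomial in
/-- **`Smooth f` is load-bearing (as the carrier of finite type): with `Smooth f` dropped the block
is FALSE at every prime.** Witness: `Y = X = Spec 𝔽_p[X]⁺`, `i = 𝟙` (an isomorphism is a closed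
immersion), `f` the affine (hence separated, quasi-compact) structure map. [folklore] -/
theorem datumToEmbedded_false_without_smooth_at (p : ℕ) [Fact p.Prime] :
    ¬ ∀ (k : Type) [Field k] [CharP k p] [PerfectField k] (Y X : Scheme.{0})
        (f : Y ⟶ Spec (.of k)) (i : X ⟶ Y), IsSeparated f → QuasiCompact f →
          IsClosedImmersion i → IsIntegral X → Scheme.HasResolution X := by
  intro h
  let f : Spec (.of ↥(integralClosure (ZMod p)[X] (AlgebraicClosure (RatFunc (ZMod p))))) ⟶
      Spec (.of (ZMod p)) :=
    Spec.map (CommRingCat.ofHom ((algebraMap (ZMod p)[X]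
      ↥(integralClosure (ZMod p)[X] (AlgebraicClosure (RatFunc (ZMod p))))).comp Polynomial.C))
  exact not_hasResolution_spec_absoluteIntegralClosure p
    (h (ZMod p) _ _ f (𝟙 _) inferInstance inferInstance inferInstance inferInstance)

end FiniteType

end Summit.ResolutionOfSingularities.ResolutionOfSingularities.Theorems.DatumToEmbedded.Negative

end
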